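import Summits.HodgeConjecture.HodgeConjecture.Theorems.F0P3cStCharTSStStableEll          -- ★ p851694 (B1) «ELL-VALUE-H»: `charSt_eq_neg_xiLocalChar_of_not_mem_hyperbolicSet` (this seat)
import Summits.HodgeConjecture.HodgeConjecture.Theorems.F0P3cStCharTSHypConjTwo          -- ★ (B3) «HYP-CONJ₂» (LH1-p03 (g8)): `isConj_of_isLocalStablyConjH_of_mem_hyperbolicSet` (brings ★ p851650 (B2) `F0P3cStCharTSStableInvariantsH`, F0P3a-p05 (g22))
import Summits.HodgeConjecture.HodgeConjecture.Theorems.F0P3cStCharTSClassFnH             -- ★ p851564 «CLASS-FN-H» (F0P2-p01 (g21)): `isAdmissible_of_hLengthTwoLabels`, `isClassFunOn_GRegular_of_charSt_clauses`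
import HarnessLib

/-!
# F0 · P3c · line LH6 «StCharTS» — road «ST-STABLE-H», brick (B4) «HSTAB-HOLDS★»: the RUNG0 antecedent `hstab` DISCHARGED IN HOUSE —
# every character function of the `H`-side Steinberg label (four pins) is a STABLE class function on the `G`-regular set of `H_v`

Cell `pub/hodgecm-mathlib`, crux H413 = `stmt-HodgeConjecture-24833` (lane `--supports … --as helper`), route HCCMUnconditional; seat F0P3-p04 (g18), road
«ST-STABLE-H★» (NAMING 2026-09-02T13:58Z, LEAD F0P3a-plan (g14) T13-40 «=»; bricks (B1) ★ p851694 this seat, (B2) ★ p851650 F0P3a-p05 (g22), (B3) ★ LH1-p03 (g8),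
(B4) this file).  THEOREMS ONLY, sorry-free, ★-only imports; no definition ∕ instance ∕ notation ∕ named fact.  HONEST LABEL: HC_CM is proved only modulo the 7 printed
citations (2 remaining: hLiu418 = stmt-HodgeConjecture-24832, h413 = stmt-HodgeConjecture-24833) until rung 0 closes; count-neutral helper — it pays, in house, the
outer antecedent `hstab` (:118–119) of ★ RUNG0 `F0P3cStCharTSRung0.ellipticPackage_of_namedBlock` (LH6-p01 (g4)), booked so far as PRINT [Rogawski1990, §12.5 p. 183
«let `α` be a stable class function on `H`», applied to `α = χ_ρ`, `ρ = St_H(ξ)`, p. 191; §11.1]; the organ text and the registry do not change.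

THE STATEMENT (`hstab` TOKEN FOR TOKEN under RUNG0's outer binders).  For every `Θ : H_v → ℂ` which is measurable, locally integrable for `νHv`, locally constant at every
`G`-regular point and computes `Tr πSt` on test functions (the four pins of `χ_{St_H(ξ_v)}`), `Θ` is an `IsStableClassFunOn (IsLocalStablyConjH L v) {G-regular}` function:
a class function there (★ CLASS-FN-H) AND constant on stable classes.  PROOF of the second half at a `G`-regular `a ∼_st b`: if `ι(a) ∈ Ω` (the regular hyperbolic set of
`U(Φ₃)`), stable conjugacy IS `H_v`-conjugacy (★ (B3) `isConj_of_isLocalStablyConjH_of_mem_hyperbolicSet`: both are conjugate to the forced torus element `d(α, (σ α)⁻¹)`),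
so the class-function half applies; if `ι(a) ∉ Ω`, then `ι(b) ∉ Ω` and `b` is `G`-regular (★ (B2), charpoly-level invariants of `∼_st`), and ★ (B1) «ELL-VALUE-H» gives
`Θ a = −ξ_v(a)`, `Θ b = −ξ_v(b)`, while `ξ_v(a) = ξ_v(b)` (★ (B2): `ξ_v` reads determinants).  Measurability and local integrability are not used.
* `stable_of_charSt_clauses` — the stability half alone (binders: `hlc`, `htr`);
* **`hstab_holds`** — the RUNG0 antecedent verbatim.

## References
* [Rogawski1990] J. D. Rogawski, *Automorphic Representations of Unitary Groups in Three Variables*, Ann. of Math. Stud. 123 (1990): §12.5 pp. 182–183; §12.7 p. 191; §11.1;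
  §12.1 pp. 171–172; §3.1 p. 19.
-/

set_option autoImplicit false
-- the mandated namespace has the single-problem summit's repeated segment (`HodgeConjecture.HodgeConjecture`)
set_option linter.dupNamespace false

noncomputable section

open NumberField IsDedekindDomain MeasureTheory Filter Topology Set
open scoped Matrix MatrixGroups
open Literature.NumberTheory Literature.NumberTheory.Automorphic Literature.NumberTheory.Automorphic.UnitaryGroup
open Literature.NumberTheory.GaloisRepresentations
open Literature.NumberTheory.Rogawski1990
open Summit.HodgeConjecture.HodgeConjecture.Cruxes.H413.F0P3cStCharTSTorusDefs

namespace Summit.HodgeConjecture.HodgeConjecture.Cruxes.H413.F0P3cStCharTSHstabHolds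

variable (L : Type) [Field L] [NumberField L] [IsCMField L] (v : HeightOneSpectrum (𝓞 ↥(maximalRealSubfield L)))

set_option maxHeartbeats 1600000 in
set_option synthInstance.maxHeartbeats 400000 in
/-- **Stability on stable classes** of any character function of the `H`-side Steinberg label: for `Θ` locally constant at the `G`-regular points and computing
`Tr πSt` on test functions (`νHv` left+right invariant, labels `(π₁, πSt)` of `i_H(χ_H)` with `Tr π₁ = χ_{ξ_v}`, non-split `v`), `Θ b = Θ a` whenever `a` is `G`-regular and
`a ∼_st b` in `H_v`.  (Case `ι a ∈ Ω`: ★ (B3) + ★ CLASS-FN-H; case `ι a ∉ Ω`: ★ (B1) + ★ (B2).) [cite: Rogawski1990, §12.5 pp. 182–183; §12.7 p. 191; §3.1 p. 19] -/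
theorem stable_of_charSt_clauses (hns : ∀ w : PlacesOver L v, IsCMField.complexConj L • w.1 = w.1)
    [MeasurableSpace (((UnitaryGroup.cmDatum L 2 (Matrix.of fun i j : Fin 2 => if i.val + j.val + 1 = 2 then (1 : L) else 0)).Local v) × ((UnitaryGroup.cmDatum L 1 (Matrix.of fun i j : Fin 1 => if i.val + j.val + 1 = 1 then (1 : L) else 0)).Local v))] [BorelSpace (((UnitaryGroup.cmDatum L 2 (Matrix.of fun i j : Fin 2 => if i.val + j.val + 1 = 2 then (1 : L) else 0)).Local v) × ((UnitaryGroup.cmDatum L 1 (Matrix.of fun i j : Fin 1 => if i.val + j.val + 1 = 1 then (1 : L) else 0)).Local v))]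
    (νHv : Measure (((UnitaryGroup.cmDatum L 2 (Matrix.of fun i j : Fin 2 => if i.val + j.val + 1 = 2 then (1 : L) else 0)).Local v) × ((UnitaryGroup.cmDatum L 1 (Matrix.of fun i j : Fin 1 => if i.val + j.val + 1 = 1 then (1 : L) else 0)).Local v))) [νHv.IsHaarMeasure] [νHv.IsMulRightInvariant]
    (ξ : OneDimAutRepH L)
    (π₁ πSt : IrrClass (((UnitaryGroup.cmDatum L 2 (Matrix.of fun i j : Fin 2 => if i.val + j.val + 1 = 2 then (1 : L) else 0)).Local v) × ((UnitaryGroup.cmDatum L 1 (Matrix.of fun i j : Fin 1 => if i.val + j.val + 1 = 1 then (1 : L) else 0)).Local v)))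
    (hlab : HLengthTwoLabels L v
      (torusCharPair (conjLocal L (IsCMField.complexConj L) v) (cmLocalForm L 2 v) (cmLocalForm_eq_over L 2 v) 0
        ((torusLocalComponent L (IsCMField.complexConj L) v ξ.η).comp
            (quotConj (conjLocal L (IsCMField.complexConj L) v) (conjLocal_conjLocal_cm L v)) *
          halfModulusChar (UnitaryGroup.LocalRing L v))
        (torusLocalComponent L (IsCMField.complexConj L) v ξ.ψ))
      ((torusLocalComponent L (IsCMField.complexConj L) v ξ.ψ).comp (localDet (IsCMField.complexConj L) v (isUnit_antidiagOne_det L 1))) π₁ πSt)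
    (hπ₁ : ∀ fH : (((UnitaryGroup.cmDatum L 2 (Matrix.of fun i j : Fin 2 => if i.val + j.val + 1 = 2 then (1 : L) else 0)).Local v) × ((UnitaryGroup.cmDatum L 1 (Matrix.of fun i j : Fin 1 => if i.val + j.val + 1 = 1 then (1 : L) else 0)).Local v)) → ℂ, IsLocSmooth fH → π₁.smoothTrace νHv fH = charDist (ξ.xiLocalChar v) νHv fH)
    (Θ : (((UnitaryGroup.cmDatum L 2 (Matrix.of fun i j : Fin 2 => if i.val + j.val + 1 = 2 then (1 : L) else 0)).Local v) × ((UnitaryGroup.cmDatum L 1 (Matrix.of fun i j : Fin 1 => if i.val + j.val + 1 = 1 then (1 : L) else 0)).Local v)) → ℂ)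
    (hlc : ∀ x : (((UnitaryGroup.cmDatum L 2 (Matrix.of fun i j : Fin 2 => if i.val + j.val + 1 = 2 then (1 : L) else 0)).Local v) × ((UnitaryGroup.cmDatum L 1 (Matrix.of fun i j : Fin 1 => if i.val + j.val + 1 = 1 then (1 : L) else 0)).Local v)), IsLocalGRegular L v x → ∀ᶠ y in 𝓝 x, Θ y = Θ x)
    (htr : ∀ fH : (((UnitaryGroup.cmDatum L 2 (Matrix.of fun i j : Fin 2 => if i.val + j.val + 1 = 2 then (1 : L) else 0)).Local v) × ((UnitaryGroup.cmDatum L 1 (Matrix.of fun i j : Fin 1 => if i.val + j.val + 1 = 1 then (1 : L) else 0)).Local v)) → ℂ, IsLocSmooth fH → πSt.smoothTrace νHv fH = ∫ h, fH h * Θ h ∂νHv)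
    {a : (((UnitaryGroup.cmDatum L 2 (Matrix.of fun i j : Fin 2 => if i.val + j.val + 1 = 2 then (1 : L) else 0)).Local v) × ((UnitaryGroup.cmDatum L 1 (Matrix.of fun i j : Fin 1 => if i.val + j.val + 1 = 1 then (1 : L) else 0)).Local v))} (ha : IsLocalGRegular L v a) (b : (((UnitaryGroup.cmDatum L 2 (Matrix.of fun i j : Fin 2 => if i.val + j.val + 1 = 2 then (1 : L) else 0)).Local v) × ((UnitaryGroup.cmDatum L 1 (Matrix.of fun i j : Fin 1 => if i.val + j.val + 1 = 1 then (1 : L) else 0)).Local v))) (hab : IsLocalStablyConjH L v a b) : Θ b = Θ a := by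
  by_cases hΩ : endoEmbLocal L v a ∈ hyperbolicSet L v
  · -- hyperbolic image: `∼_st` is `H_v`-conjugacy (★ (B3)); `Θ` is a class function on the `G`-regular set (★ CLASS-FN-H)
    obtain ⟨c, hc⟩ := isConj_iff.1 (F0P3cStCharTSHypConjTwo.isConj_of_isLocalStablyConjH_of_mem_hyperbolicSet L v hns hab ha hΩ)
    have hψc := continuous_torusLocalComponent L (IsCMField.complexConj L) (v := v) ξ.ψ
    have hχ₁c : Continuous fun x : ((UnitaryGroup.cmDatum L 1 (Matrix.of fun i j : Fin 1 => if i.val + j.val + 1 = 1 then (1 : L) else 0)).Local v) => ((((torusLocalComponent L (IsCMField.complexConj L) v ξ.ψ).comp (localDet (IsCMField.complexConj L) v (isUnit_antidiagOne_det L 1))) x : ℂˣ) : ℂ) :=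
      hψc.comp (continuous_localDet (IsCMField.complexConj L) v (isUnit_antidiagOne_det L 1)
        (J := (Matrix.of fun i j : Fin 1 => if i.val + j.val + 1 = 1 then (1 : L) else 0)))
    have hadm := F0P3cStCharTSClassFnH.isAdmissible_of_hLengthTwoLabels L v _ _ hχ₁c π₁ πSt hlab
    have hcl := F0P3cStCharTSClassFnH.isClassFunOn_GRegular_of_charSt_clauses L v νHv πSt hadm Θ hlc htr
    rw [← hc]
    exact hcl a ha c
  · -- elliptic image: both values are `−ξ_v`, and `ξ_v` is stable (★ (B1), ★ (B2))
    have hb : IsLocalGRegular L v b := (F0P3cStCharTSStableInvariantsH.isLocalGRegular_iff_of_isLocalStablyConjH L v hab).1 ha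
    have hbΩ : endoEmbLocal L v b ∉ hyperbolicSet L v :=
      fun h => hΩ ((F0P3cStCharTSStableInvariantsH.endoEmbLocal_mem_hyperbolicSet_iff_of_isLocalStablyConjH L v hns hab).2 h)
    rw [F0P3cStCharTSStStableEll.charSt_eq_neg_xiLocalChar_of_not_mem_hyperbolicSet L v hns νHv ξ π₁ πSt hlab hπ₁ Θ hlc htr ha hΩ,
      F0P3cStCharTSStStableEll.charSt_eq_neg_xiLocalChar_of_not_mem_hyperbolicSet L v hns νHv ξ π₁ πSt hlab hπ₁ Θ hlc htr hb hbΩ,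
      F0P3cStCharTSStableInvariantsH.xiLocalChar_eq_of_isLocalStablyConjH L v ξ hab]

set_option maxHeartbeats 1600000 in
set_option synthInstance.maxHeartbeats 400000 in
/-- **«HSTAB-HOLDS★»: the RUNG0 antecedent `hstab` of ★ `F0P3cStCharTSRung0.ellipticPackage_of_namedBlock` (:118–119), TOKEN FOR TOKEN, PROVED** — under the
organ's outer binders (`νHv` Haar + right-invariant, `ξ`, the labels `π₁ πSt` with `hlab`, `hπ₁`, non-split `v`): every `Θ : H_v → ℂ` with the four pins of
`χ_{St_H(ξ_v)}` is `IsStableClassFunOn (IsLocalStablyConjH L v) {a | IsLocalGRegular L v a} Θ` — the class-function half by ★ CLASS-FN-H, the stability half by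
`stable_of_charSt_clauses`.  The print sentence [§12.5 p. 183; §11.1] thereby leaves the named inputs of (S-𝔇). [cite: Rogawski1990, §12.5 pp. 182–183; §12.7 p. 191; §11.1] -/
theorem hstab_holds (hns : ∀ w : PlacesOver L v, IsCMField.complexConj L • w.1 = w.1)
    [MeasurableSpace (((UnitaryGroup.cmDatum L 2 (Matrix.of fun i j : Fin 2 => if i.val + j.val + 1 = 2 then (1 : L) else 0)).Local v) × ((UnitaryGroup.cmDatum L 1 (Matrix.of fun i j : Fin 1 => if i.val + j.val + 1 = 1 then (1 : L) else 0)).Local v))] [BorelSpace (((UnitaryGroup.cmDatum L 2 (Matrix.of fun i j : Fin 2 => if i.val + j.val + 1 = 2 then (1 : L) else 0)).Local v) × ((UnitaryGroup.cmDatum L 1 (Matrix.of fun i j : Fin 1 => if i.val + j.val + 1 = 1 then (1 : L) else 0)).Local v))]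
    (νHv : Measure (((UnitaryGroup.cmDatum L 2 (Matrix.of fun i j : Fin 2 => if i.val + j.val + 1 = 2 then (1 : L) else 0)).Local v) × ((UnitaryGroup.cmDatum L 1 (Matrix.of fun i j : Fin 1 => if i.val + j.val + 1 = 1 then (1 : L) else 0)).Local v))) [νHv.IsHaarMeasure] [νHv.IsMulRightInvariant]
    (ξ : OneDimAutRepH L)
    (π₁ πSt : IrrClass (((UnitaryGroup.cmDatum L 2 (Matrix.of fun i j : Fin 2 => if i.val + j.val + 1 = 2 then (1 : L) else 0)).Local v) × ((UnitaryGroup.cmDatum L 1 (Matrix.of fun i j : Fin 1 => if i.val + j.val + 1 = 1 then (1 : L) else 0)).Local v)))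
    (hlab : HLengthTwoLabels L v
      (torusCharPair (conjLocal L (IsCMField.complexConj L) v) (cmLocalForm L 2 v) (cmLocalForm_eq_over L 2 v) 0
        ((torusLocalComponent L (IsCMField.complexConj L) v ξ.η).comp
            (quotConj (conjLocal L (IsCMField.complexConj L) v) (conjLocal_conjLocal_cm L v)) *
          halfModulusChar (UnitaryGroup.LocalRing L v))
        (torusLocalComponent L (IsCMField.complexConj L) v ξ.ψ))
      ((torusLocalComponent L (IsCMField.complexConj L) v ξ.ψ).comp (localDet (IsCMField.complexConj L) v (isUnit_antidiagOne_det L 1))) π₁ πSt)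
    (hπ₁ : ∀ fH : (((UnitaryGroup.cmDatum L 2 (Matrix.of fun i j : Fin 2 => if i.val + j.val + 1 = 2 then (1 : L) else 0)).Local v) × ((UnitaryGroup.cmDatum L 1 (Matrix.of fun i j : Fin 1 => if i.val + j.val + 1 = 1 then (1 : L) else 0)).Local v)) → ℂ, IsLocSmooth fH → π₁.smoothTrace νHv fH = charDist (ξ.xiLocalChar v) νHv fH) :
    ∀ Θ : (((UnitaryGroup.cmDatum L 2 (Matrix.of fun i j : Fin 2 => if i.val + j.val + 1 = 2 then (1 : L) else 0)).Local v) × ((UnitaryGroup.cmDatum L 1 (Matrix.of fun i j : Fin 1 => if i.val + j.val + 1 = 1 then (1 : L) else 0)).Local v)) → ℂ, (Measurable Θ ∧ LocallyIntegrable Θ νHv ∧ (∀ x : (((UnitaryGroup.cmDatum L 2 (Matrix.of fun i j : Fin 2 => if i.val + j.val + 1 = 2 then (1 : L) else 0)).Local v) × ((UnitaryGroup.cmDatum L 1 (Matrix.of fun i j : Fin 1 => if i.val + j.val + 1 = 1 then (1 : L) else 0)).Local v)), IsLocalGRegular L v x → ∀ᶠ y in 𝓝 x, Θ y = Θ x)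 ∧ (∀ fH : (((UnitaryGroup.cmDatum L 2 (Matrix.of fun i j : Fin 2 => if i.val + j.val + 1 = 2 then (1 : L) else 0)).Local v) × ((UnitaryGroup.cmDatum L 1 (Matrix.of fun i j : Fin 1 => if i.val + j.val + 1 = 1 then (1 : L) else 0)).Local v)) → ℂ, IsLocSmooth fH → πSt.smoothTrace νHv fH = ∫ h, fH h * Θ h ∂νHv)) → Ch12Sec5.IsStableClassFunOn (fun a b : (((UnitaryGroup.cmDatum L 2 (Matrix.of fun i j : Fin 2 => if i.val + j.val + 1 = 2 then (1 : L) else 0)).Local v) × ((UnitaryGroup.cmDatum L 1 (Matrix.of fun i j : Fin 1 => if i.val + j.val + 1 = 1 then (1 : L) else 0)).Local v)) => IsLocalStablyConjH L v a b) {a : (((UnitaryGroup.cmDatum L 2 (Matrix.of fun i j : Fin 2 => if i.val + j.val + 1 = 2 then (1 : L) else 0)).Local v) × ((UnitaryGroup.cmDatum L 1 (Matrix.of fun i j : Fin 1 => if i.val + j.val + 1 = 1 then (1 : L) else 0)).Local v)) | IsLocalGRegular L v a} Θ := by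
  intro Θ hΘ
  obtain ⟨-, -, hlc, htr⟩ := hΘ
  have hψc := continuous_torusLocalComponent L (IsCMField.complexConj L) (v := v) ξ.ψ
  have hχ₁c : Continuous fun x : ((UnitaryGroup.cmDatum L 1 (Matrix.of fun i j : Fin 1 => if i.val + j.val + 1 = 1 then (1 : L) else 0)).Local v) => ((((torusLocalComponent L (IsCMField.complexConj L) v ξ.ψ).comp (localDet (IsCMField.complexConj L) v (isUnit_antidiagOne_det L 1))) x : ℂˣ) : ℂ) :=
    hψc.comp (continuous_localDet (IsCMField.complexConj L) v (isUnit_antidiagOne_det L 1)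
      (J := (Matrix.of fun i j : Fin 1 => if i.val + j.val + 1 = 1 then (1 : L) else 0)))
  have hadm := F0P3cStCharTSClassFnH.isAdmissible_of_hLengthTwoLabels L v _ _ hχ₁c π₁ πSt hlab
  exact ⟨F0P3cStCharTSClassFnH.isClassFunOn_GRegular_of_charSt_clauses L v νHv πSt hadm Θ hlc htr,
    fun a ha b hab => stable_of_charSt_clauses L v hns νHv ξ π₁ πSt hlab hπ₁ Θ hlc htr ha b hab⟩

end Summit.HodgeConjecture.HodgeConjecture.Cruxes.H413.F0P3cStCharTSHstabHolds

end
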